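import Mathlib
import HarnessLib

/-!
# Stub `stub_finiteTruncation` (T3b) for the crux `WeakCouplingHypercubicLimit` (line `Sketch`)

**Finite-dimensional transfer models from spectral data** (spectral truncation).  Given a Hilbert
basis `(bᵢ)` of a real Hilbert space, weights `0 ≤ λᵢ ≤ λ_{i₀}` with `λ_{i₀} > 0`, `Σ λᵢ² < ∞`, and
bounded operators `Â`, `B̂` with `‖Â‖ ≤ C_A λ_{i₀}^{r+1}`, `‖B̂‖ ≤ C_B λ_{i₀}^{r+1}`, the normalised
spectral sums

  `Σ_{(i,j)} λⱼ^{a+2} λᵢ^{b'+2} ⟪bᵢ, Â bⱼ⟫ ⟪bⱼ, B̂ bᵢ⟫ / Σ λᵢᴺ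
     − (Σ λᵢ^{N−r−1} ⟪bᵢ, Â bᵢ⟫ / Σ λᵢᴺ) (Σ λᵢ^{N−r−1} ⟪bᵢ, B̂ bᵢ⟫ / Σ λᵢᴺ)`, `N = 2r + a + b' + 6`,

(all four series converge absolutely) are, for every `ε > 0`, reproduced to within `ε` by the
normalised traces of a finite model on `ℝᵈ`: a finite set of indices `F ∋ i₀` (a partial sum
close enough to the four sums), `d = |F|`, `T = diag(λᵢ/λ_{i₀})_{i∈F}` (so `T ≥ 0`, `‖T‖ ≤ 1`,
`T Ω = Ω` for `Ω = e_{i₀}`), `Ao = (⟪bᵢ, Â bⱼ⟫ / λ_{i₀}^{r+1})_{i,j∈F}` (a scaled compression, so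
`‖Ao‖ ≤ C_A` by Bessel's inequality), `Bo` likewise, and `tr T^{m+2} ≤ Σᵢ (λᵢ/λ_{i₀})^{m+2}`.
The powers of `λ_{i₀}` cancel in each normalised trace, so the model quantity *equals* the
`F`-partial-sum version of the spectral quantity; the `ε`-closeness is continuity of
`(p, q, s, z) ↦ p/z − (q/z)(s/z)` at `z = Σ λᵢᴺ ≥ λ_{i₀}ᴺ > 0` along the partial sums.
Mathlib only (`Matrix.toEuclideanCLM`, `Matrix.trace_toLin_eq`, `Orthonormal.sum_inner_products_le`,
`tendsto_finsetProd_atTop`). [folklore]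
-/

noncomputable section

open scoped BigOperators Topology InnerProductSpace
open MeasureTheory Filter

namespace Summit.QuantumFields.YangMills.Theorems.WeakCouplingHypercubicLimit.TraceNormColdPressure

section FiniteModel

variable {d : ℕ}

/-- The trace of the operator on `ℝᵈ` attached to a real `d × d` matrix is the matrix trace.
[folklore] -/
private theorem trace_toEuclideanCLM (M : Matrix (Fin d) (Fin d) ℝ) :
    LinearMap.trace ℝ _ (↑(Matrix.toEuclideanCLM (𝕜 := ℝ) M) :
      EuclideanSpace ℝ (Fin d) →ₗ[ℝ] EuclideanSpace ℝ (Fin d)) = M.trace := by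
  rw [Matrix.coe_toEuclideanCLM_eq_toEuclideanLin, Matrix.toEuclideanLin_eq_toLin_orthonormal,
    Matrix.trace_toLin_eq]

/-- A real diagonal matrix with nonnegative entries acts on `ℝᵈ` as a positive operator.
[folklore] -/
private theorem isPositive_toEuclideanCLM_diagonal {t : Fin d → ℝ} (ht : ∀ k, 0 ≤ t k) :
    (Matrix.toEuclideanCLM (𝕜 := ℝ) (Matrix.diagonal t)).IsPositive := by
  rw [← ContinuousLinearMap.isPositive_toLinearMap_iff,
    Matrix.coe_toEuclideanCLM_eq_toEuclideanLin, Matrix.isPositive_toEuclideanLin_iff,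
    Matrix.posSemidef_diagonal_iff]
  exact ht

/-- Coordinates of the action of a matrix on `ℝᵈ`. [folklore] -/
private theorem toEuclideanCLM_apply (M : Matrix (Fin d) (Fin d) ℝ)
    (v : EuclideanSpace ℝ (Fin d)) (k : Fin d) :
    Matrix.toEuclideanCLM (𝕜 := ℝ) M v k = ∑ l, M k l * v l := by
  rw [← WithLp.toLp_ofLp (p := 2) v, Matrix.toEuclideanCLM_toLp]
  simp [Matrix.mulVec, dotProduct]

/-- Coordinates of the action of a diagonal matrix on `ℝᵈ`. [folklore] -/
private theorem toEuclideanCLM_diagonal_apply (t : Fin d → ℝ) (v : EuclideanSpace ℝ (Fin d))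
    (k : Fin d) : Matrix.toEuclideanCLM (𝕜 := ℝ) (Matrix.diagonal t) v k = t k * v k := by
  rw [← WithLp.toLp_ofLp (p := 2) v, Matrix.toEuclideanCLM_toLp]
  simp [Matrix.mulVec_diagonal]

/-- A diagonal operator on `ℝᵈ` with entries in `[0, 1]` is a contraction. [folklore] -/
private theorem norm_toEuclideanCLM_diagonal_apply_le {t : Fin d → ℝ}
    (ht : ∀ k, 0 ≤ t k ∧ t k ≤ 1) (v : EuclideanSpace ℝ (Fin d)) :
    ‖Matrix.toEuclideanCLM (𝕜 := ℝ) (Matrix.diagonal t) v‖ ≤ ‖v‖ := by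
  refine (sq_le_sq₀ (norm_nonneg _) (norm_nonneg _)).mp ?_
  rw [EuclideanSpace.real_norm_sq_eq, EuclideanSpace.real_norm_sq_eq]
  refine Finset.sum_le_sum fun k _ => ?_
  rw [toEuclideanCLM_diagonal_apply, mul_pow]
  have h1 : t k ^ 2 ≤ 1 := pow_le_one₀ (ht k).1 (ht k).2
  nlinarith [sq_nonneg (v k)]

/-- A diagonal operator on `ℝᵈ` fixes the coordinate vector at which its entry is `1`.
[folklore] -/
private theorem toEuclideanCLM_diagonal_single {t : Fin d → ℝ} {k : Fin d} (hk : t k = 1) :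
    Matrix.toEuclideanCLM (𝕜 := ℝ) (Matrix.diagonal t) (EuclideanSpace.single k 1) =
      EuclideanSpace.single k 1 := by
  ext j
  rw [toEuclideanCLM_diagonal_apply]
  by_cases h : j = k
  · subst h
    simp [hk]
  · simp [h]

/-- The compression `(⟪u_k, A u_l⟫)_{k,l}` of a bounded operator to the span of a finite
orthonormal family, as an operator on `ℝᵈ`, has norm at most `‖A‖` (Bessel's inequality).
[folklore] -/
private theorem norm_toEuclideanCLM_compression_le {E : Type*} [NormedAddCommGroup E]
    [InnerProductSpace ℝ E] {u : Fin d → E} (hu : Orthonormal ℝ u) (A : E →L[ℝ] E) :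
    ‖Matrix.toEuclideanCLM (𝕜 := ℝ) (Matrix.of fun k l => ⟪u k, A (u l)⟫_ℝ)‖ ≤ ‖A‖ := by
  refine ContinuousLinearMap.opNorm_le_bound _ (norm_nonneg A) fun v => ?_
  set φ : E := ∑ l, v l • u l with hφ
  have hφn : ‖φ‖ = ‖v‖ := by
    refine (sq_eq_sq₀ (norm_nonneg _) (norm_nonneg _)).mp ?_
    rw [← real_inner_self_eq_norm_sq, hφ, hu.inner_sum, EuclideanSpace.real_norm_sq_eq]
    refine Finset.sum_congr rfl fun l _ => ?_
    simp [sq]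
  have hcoord : ∀ k, Matrix.toEuclideanCLM (𝕜 := ℝ) (Matrix.of fun k l => ⟪u k, A (u l)⟫_ℝ) v k =
      ⟪u k, A φ⟫_ℝ := by
    intro k
    rw [toEuclideanCLM_apply, hφ, map_sum, inner_sum]
    refine Finset.sum_congr rfl fun l _ => ?_
    simp only [Matrix.of_apply]
    rw [map_smul, real_inner_smul_right, mul_comm]
  have hsq : ‖Matrix.toEuclideanCLM (𝕜 := ℝ) (Matrix.of fun k l => ⟪u k, A (u l)⟫_ℝ) v‖ ^ 2 ≤
      (‖A‖ * ‖v‖) ^ 2 := by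
    rw [EuclideanSpace.real_norm_sq_eq]
    calc ∑ k, (Matrix.toEuclideanCLM (𝕜 := ℝ) (Matrix.of fun k l => ⟪u k, A (u l)⟫_ℝ) v k) ^ 2
        = ∑ k, ‖⟪u k, A φ⟫_ℝ‖ ^ 2 :=
          Finset.sum_congr rfl fun k _ => by rw [hcoord, Real.norm_eq_abs, sq_abs]
      _ ≤ ‖A φ‖ ^ 2 := hu.sum_inner_products_le (A φ)
      _ ≤ (‖A‖ * ‖φ‖) ^ 2 := pow_le_pow_left₀ (norm_nonneg _) (A.le_opNorm φ) 2
      _ = (‖A‖ * ‖v‖) ^ 2 := by rw [hφn]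
  exact (sq_le_sq₀ (norm_nonneg _) (by positivity)).mp hsq

/-- Scaled form of the compression bound: if `‖A‖ ≤ C c` with `c > 0` then the compression with
entries `⟪u_k, A u_l⟫ / c` has norm at most `C`. [folklore] -/
private theorem norm_toEuclideanCLM_compression_div_le {E : Type*} [NormedAddCommGroup E]
    [InnerProductSpace ℝ E] {u : Fin d → E} (hu : Orthonormal ℝ u) (A : E →L[ℝ] E) {c C : ℝ}
    (hc : 0 < c) (hA : ‖A‖ ≤ C * c) :
    ‖Matrix.toEuclideanCLM (𝕜 := ℝ) (Matrix.of fun k l => ⟪u k, A (u l)⟫_ℝ / c)‖ ≤ C := by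
  have e : (Matrix.of fun k l => ⟪u k, A (u l)⟫_ℝ / c) =
      c⁻¹ • Matrix.of fun k l => ⟪u k, A (u l)⟫_ℝ := by
    ext k l
    simp [div_eq_inv_mul]
  rw [e, map_smul, norm_smul, norm_inv, Real.norm_of_nonneg hc.le]
  calc c⁻¹ * ‖Matrix.toEuclideanCLM (𝕜 := ℝ) (Matrix.of fun k l => ⟪u k, A (u l)⟫_ℝ)‖
      ≤ c⁻¹ * (C * c) :=
        mul_le_mul_of_nonneg_left ((norm_toEuclideanCLM_compression_le hu A).trans hA)
          (inv_nonneg.mpr hc.le)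
    _ = C := by field_simp

/-- `tr (diag t)ⁿ = Σ_k t_kⁿ`. [folklore] -/
private theorem trace_diagonal_pow (t : Fin d → ℝ) (n : ℕ) :
    Matrix.trace (Matrix.diagonal t ^ n) = ∑ k, t k ^ n := by
  rw [Matrix.diagonal_pow, Matrix.trace_diagonal]
  rfl

/-- `tr ((diag t)ⁿ M) = Σ_k t_kⁿ M_{kk}`. [folklore] -/
private theorem trace_diagonal_pow_mul (t : Fin d → ℝ) (n : ℕ) (M : Matrix (Fin d) (Fin d) ℝ) :
    Matrix.trace (Matrix.diagonal t ^ n * M) = ∑ k, t k ^ n * M k k := by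
  rw [Matrix.diagonal_pow]
  simp [Matrix.trace, Matrix.diagonal_mul]

/-- `tr ((diag t)ᵐ M (diag t)ⁿ M') = Σ_{k,l} t_kᵐ M_{kl} t_lⁿ M'_{lk}`. [folklore] -/
private theorem trace_diagonal_pow_mul_mul (t : Fin d → ℝ) (m n : ℕ)
    (M M' : Matrix (Fin d) (Fin d) ℝ) :
    Matrix.trace (Matrix.diagonal t ^ m * M * Matrix.diagonal t ^ n * M') =
      ∑ k, ∑ l, t k ^ m * M k l * t l ^ n * M' l k := by
  rw [Matrix.diagonal_pow, Matrix.diagonal_pow]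
  simp only [Matrix.trace, Matrix.diag_apply]
  refine Finset.sum_congr rfl fun k _ => ?_
  rw [Matrix.mul_apply]
  refine Finset.sum_congr rfl fun l _ => ?_
  rw [Matrix.mul_diagonal, Matrix.diagonal_mul]
  rfl

end FiniteModel

section Limit

/-- The normalised partial sums `P_F/Z_F − (A_F/Z_F)(B_F/Z_F)` (over `F × F` resp. `F`) of four
summable families converge, along the finite sets `F`, to the same expression in the sums, when
the limit denominator is nonzero; hence some `F ∋ i₀` is `ε`-close. [folklore] -/
private theorem exists_finset_approx {ι : Type*} {fP : ι × ι → ℝ} {fA fB fZ : ι → ℝ}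
    (hP : Summable fP) (hA : Summable fA) (hB : Summable fB) (hZ : Summable fZ)
    (hZ0 : ∑' i, fZ i ≠ 0) (i₀ : ι) {ε : ℝ} (hε : 0 < ε) :
    ∃ F : Finset ι, i₀ ∈ F ∧
      |(∑' pr, fP pr) / (∑' i, fZ i) - (∑' i, fA i) / (∑' i, fZ i) * ((∑' i, fB i) / (∑' i, fZ i)) -
        ((∑ pr ∈ F ×ˢ F, fP pr) / (∑ i ∈ F, fZ i) -
          (∑ i ∈ F, fA i) / (∑ i ∈ F, fZ i) * ((∑ i ∈ F, fB i) / (∑ i ∈ F, fZ i)))| ≤ ε := by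
  have tP : Tendsto (fun F : Finset ι => ∑ pr ∈ F ×ˢ F, fP pr) atTop (𝓝 (∑' pr, fP pr)) :=
    hP.hasSum.comp (tendsto_finsetProd_atTop.comp tendsto_atTop_diagonal)
  have tA : Tendsto (fun F : Finset ι => ∑ i ∈ F, fA i) atTop (𝓝 (∑' i, fA i)) := hA.hasSum
  have tB : Tendsto (fun F : Finset ι => ∑ i ∈ F, fB i) atTop (𝓝 (∑' i, fB i)) := hB.hasSum
  have tZ : Tendsto (fun F : Finset ι => ∑ i ∈ F, fZ i) atTop (𝓝 (∑' i, fZ i)) := hZ.hasSum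
  have tΦ := (tP.div tZ hZ0).sub ((tA.div tZ hZ0).mul (tB.div tZ hZ0))
  obtain ⟨F, hF1, hF2⟩ :=
    ((eventually_ge_atTop ({i₀} : Finset ι)).and (Metric.tendsto_nhds.mp tΦ ε hε)).exists
  refine ⟨F, Finset.singleton_subset_iff.mp hF1, ?_⟩
  rw [abs_sub_comm, ← Real.dist_eq]
  exact hF2.le

end Limit

section Main

/-- `stub_finiteTruncation` (T3b) — **finite-dimensional transfer models from spectral data**
(spectral truncation).  Given a countable Hilbert basis `(bᵢ)` of a real Hilbert space, weights
`0 ≤ λᵢ ≤ λ_{i₀}`, `λ_{i₀} > 0`, `Σ λᵢ² < ∞`, and bounded operators `Â`, `B̂` with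
`‖Â‖ ≤ C_A λ_{i₀}^{r+1}`, `‖B̂‖ ≤ C_B λ_{i₀}^{r+1}`: for every `ε > 0` a finite set of indices `F ∋ i₀`
gives the model `T = diag(λᵢ/λ_{i₀})_{i∈F}` on `ℝ^F`, `Ω = e_{i₀}`, `Ao = (⟪bᵢ, Â bⱼ⟫/λ_{i₀}^{r+1})`,
`Bo` likewise — `T ≥ 0`, `TΩ = Ω`, `‖T‖ ≤ 1`, `‖Ao‖ ≤ C_A`, `‖Bo‖ ≤ C_B` (compressions, Bessel),
`tr T^{m+2} − 1 ≤ Σᵢ(λᵢ/λ_{i₀})^{m+2} − 1` — whose normalised traces reproduce the normalised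
spectral sums `Σ_{(i,j)} λⱼ^{a+2}λᵢ^{b'+2}⟪bᵢ,Âbⱼ⟫⟪bⱼ,B̂bᵢ⟫ / Σλᵢᴺ − (Σλᵢ^{N−r−1}⟪bᵢ,Âbᵢ⟫/Σλᵢᴺ)
(Σλᵢ^{N−r−1}⟪bᵢ,B̂bᵢ⟫/Σλᵢᴺ)`, `N = 2r + a + b' + 6`, to within `ε` (the `λ_{i₀}`-powers cancel, so
the model quantity is the `F`-partial-sum quantity; partial sums of absolutely convergent series
converge). [folklore] -/
theorem stub_finiteTruncation :
    ∀ (E : Type) [NormedAddCommGroup E] [InnerProductSpace ℝ E] [CompleteSpace E] (ι : Type) [Countable ι]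
      (b : HilbertBasis ι ℝ E) (lam : ι → ℝ) (i₀ : ι) (Aop Bop : E →L[ℝ] E) (CA CB : ℝ) (r a b' : ℕ),
      (∀ i, 0 ≤ lam i ∧ lam i ≤ lam i₀) → 0 < lam i₀ → Summable (fun i => lam i ^ 2) →
      ‖Aop‖ ≤ CA * lam i₀ ^ (r + 1) → ‖Bop‖ ≤ CB * lam i₀ ^ (r + 1) →
    ∀ ε : ℝ, 0 < ε →
      ∃ (d : ℕ) (T Ao Bo : EuclideanSpace ℝ (Fin d) →L[ℝ] EuclideanSpace ℝ (Fin d)) (Ω : EuclideanSpace ℝ (Fin d)),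
        T.IsPositive ∧ ‖Ω‖ = 1 ∧ T Ω = Ω ∧ (∀ v, inner ℝ Ω v = 0 → ‖T v‖ ≤ ‖v‖) ∧ ‖T‖ ≤ 1 ∧
        ‖Ao‖ ≤ CA ∧ ‖Bo‖ ≤ CB ∧
        (∀ m : ℕ, LinearMap.trace ℝ _ (↑(T ^ (m + 2)) : EuclideanSpace ℝ (Fin d) →ₗ[ℝ] EuclideanSpace ℝ (Fin d)) - 1 ≤ (∑' i, lam i ^ (m + 2)) / lam i₀ ^ (m + 2) - 1) ∧
        |(∑' pr : ι × ι, lam pr.2 ^ (a + 2) * lam pr.1 ^ (b' + 2) * inner ℝ (b pr.1) (Aop (b pr.2)) * inner ℝ (b pr.2) (Bop (b pr.1))) /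
              (∑' i, lam i ^ (2 * r + a + b' + 4 + 2)) -
            (∑' i, lam i ^ (r + a + b' + 5) * inner ℝ (b i) (Aop (b i))) / (∑' i, lam i ^ (2 * r + a + b' + 4 + 2)) *
              ((∑' i, lam i ^ (r + a + b' + 5) * inner ℝ (b i) (Bop (b i))) / (∑' i, lam i ^ (2 * r + a + b' + 4 + 2))) -
          (LinearMap.trace ℝ _ (↑(T ^ (b' + 2) * Ao * T ^ (a + 2) * Bo) : EuclideanSpace ℝ (Fin d) →ₗ[ℝ] EuclideanSpace ℝ (Fin d)) / LinearMap.trace ℝ _ (↑(T ^ (2 * r + a + b' + 4 + 2)) : EuclideanSpace ℝ (Fin d) →ₗ[ℝ] EuclideanSpace ℝ (Fin d)) -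
            LinearMap.trace ℝ _ (↑(T ^ (r + a + b' + 5) * Ao) : EuclideanSpace ℝ (Fin d) →ₗ[ℝ] EuclideanSpace ℝ (Fin d)) / LinearMap.trace ℝ _ (↑(T ^ (2 * r + a + b' + 4 + 2)) : EuclideanSpace ℝ (Fin d) →ₗ[ℝ] EuclideanSpace ℝ (Fin d)) *
              (LinearMap.trace ℝ _ (↑(T ^ (r + a + b' + 5) * Bo) : EuclideanSpace ℝ (Fin d) →ₗ[ℝ] EuclideanSpace ℝ (Fin d)) / LinearMap.trace ℝ _ (↑(T ^ (2 * r + a + b' + 4 + 2)) : EuclideanSpace ℝ (Fin d) →ₗ[ℝ] EuclideanSpace ℝ (Fin d))))| ≤ ε := by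
  intro E _ _ _ ι _ b lam i₀ Aop Bop CA CB r a b' hlam hL hsum2 hA hB ε hε
  have hnn : ∀ i, 0 ≤ lam i := fun i => (hlam i).1
  have hle : ∀ i, lam i ≤ lam i₀ := fun i => (hlam i).2
  have hL0 : lam i₀ ≠ 0 := hL.ne'
  have hb1 : ∀ i, ‖b i‖ = 1 := fun i => b.orthonormal.1 i
  have hinner : ∀ (A : E →L[ℝ] E) (i j : ι), |⟪b i, A (b j)⟫_ℝ| ≤ ‖A‖ := fun A i j => by
    calc |⟪b i, A (b j)⟫_ℝ| ≤ ‖b i‖ * ‖A (b j)‖ := abs_real_inner_le_norm _ _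
      _ ≤ ‖b i‖ * (‖A‖ * ‖b j‖) := by
          gcongr
          exact A.le_opNorm _
      _ = ‖A‖ := by rw [hb1, hb1]; ring
  -- summability: powers `λᵢⁿ`, `n ≥ 2`, and the three families with inner products
  have hsumPow : ∀ n : ℕ, 2 ≤ n → Summable (fun i => lam i ^ n) := fun n hn => by
    obtain ⟨k, rfl⟩ := Nat.exists_eq_add_of_le' hn
    refine Summable.of_nonneg_of_le (fun i => pow_nonneg (hnn i) _) (fun i => ?_)
      (hsum2.mul_left (lam i₀ ^ k))
    rw [pow_add]
    exact mul_le_mul_of_nonneg_right (pow_le_pow_left₀ (hnn i) (hle i) k) (sq_nonneg _)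
  have hsumZ : Summable (fun i => lam i ^ (2 * r + a + b' + 4 + 2)) := hsumPow _ (by omega)
  have hsumD : ∀ A : E →L[ℝ] E,
      Summable (fun i => lam i ^ (r + a + b' + 5) * ⟪b i, A (b i)⟫_ℝ) := fun A => by
    refine Summable.of_norm_bounded ((hsumPow (r + a + b' + 5) (by omega)).mul_right ‖A‖)
      fun i => ?_
    rw [Real.norm_eq_abs, abs_mul, abs_of_nonneg (pow_nonneg (hnn i) _)]
    exact mul_le_mul_of_nonneg_left (hinner A i i) (pow_nonneg (hnn i) _)
  have hsumP : Summable (fun pr : ι × ι => lam pr.2 ^ (a + 2) * lam pr.1 ^ (b' + 2) *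
      ⟪b pr.1, Aop (b pr.2)⟫_ℝ * ⟪b pr.2, Bop (b pr.1)⟫_ℝ) := by
    have h1 : Summable (fun i => lam i ^ (b' + 2)) := hsumPow (b' + 2) (by omega)
    have h2 : Summable (fun i => lam i ^ (a + 2)) := hsumPow (a + 2) (by omega)
    have hprod : Summable (fun pr : ι × ι => lam pr.1 ^ (b' + 2) * lam pr.2 ^ (a + 2)) :=
      h1.mul_of_nonneg h2 (fun i => pow_nonneg (hnn i) (b' + 2))
        (fun i => pow_nonneg (hnn i) (a + 2))
    refine Summable.of_norm_bounded (hprod.mul_right (‖Aop‖ * ‖Bop‖)) fun pr => ?_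
    rw [Real.norm_eq_abs, abs_mul, abs_mul, abs_mul, abs_of_nonneg (pow_nonneg (hnn _) _),
      abs_of_nonneg (pow_nonneg (hnn _) _)]
    have h3 : 0 ≤ lam pr.2 ^ (a + 2) * lam pr.1 ^ (b' + 2) :=
      mul_nonneg (pow_nonneg (hnn _) _) (pow_nonneg (hnn _) _)
    calc lam pr.2 ^ (a + 2) * lam pr.1 ^ (b' + 2) * |⟪b pr.1, Aop (b pr.2)⟫_ℝ| *
          |⟪b pr.2, Bop (b pr.1)⟫_ℝ|
        ≤ lam pr.2 ^ (a + 2) * lam pr.1 ^ (b' + 2) * ‖Aop‖ * ‖Bop‖ :=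
          mul_le_mul (mul_le_mul_of_nonneg_left (hinner Aop _ _) h3) (hinner Bop _ _)
            (abs_nonneg _) (mul_nonneg h3 (norm_nonneg _))
      _ = lam pr.1 ^ (b' + 2) * lam pr.2 ^ (a + 2) * (‖Aop‖ * ‖Bop‖) := by ring
  have hZpos : 0 < ∑' i, lam i ^ (2 * r + a + b' + 4 + 2) :=
    lt_of_lt_of_le (pow_pos hL _) (hsumZ.le_tsum i₀ fun j _ => pow_nonneg (hnn j) _)
  -- a finite set of indices whose partial sums are `ε`-close
  obtain ⟨F, hi₀, hF⟩ :=
    exists_finset_approx hsumP (hsumD Aop) (hsumD Bop) hsumZ hZpos.ne' i₀ hε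
  -- enumerate `F`
  obtain ⟨d, e⟩ : Σ d : ℕ, ↥F ≃ Fin d := ⟨_, F.equivFin⟩
  obtain ⟨σ, hσ⟩ : ∃ σ : Fin d → ι, ∀ k, σ k = ((e.symm k : F) : ι) := ⟨_, fun _ => rfl⟩
  have hσinj : Function.Injective σ := fun k l h => by
    rw [hσ, hσ] at h
    exact e.symm.injective (Subtype.ext h)
  have hσ₀ : σ (e ⟨i₀, hi₀⟩) = i₀ := by rw [hσ, Equiv.symm_apply_apply]
  have hu : Orthonormal ℝ (fun k => b (σ k)) := b.orthonormal.comp σ hσinj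
  have reidx : ∀ g : ι → ℝ, ∑ k, g (σ k) = ∑ i ∈ F, g i := fun g => by
    simp only [hσ]
    rw [e.symm.sum_comp (fun x : F => g (x : ι)), Finset.sum_coe_sort]
  have reidx₂ : ∀ g : ι → ι → ℝ, ∑ k, ∑ l, g (σ k) (σ l) = ∑ pr ∈ F ×ˢ F, g pr.1 pr.2 := by
    intro g
    rw [Finset.sum_product', ← reidx (fun i => ∑ j ∈ F, g i j)]
    exact Finset.sum_congr rfl fun k _ => reidx (g (σ k))
  -- the ingredients of the model
  obtain ⟨t, ht⟩ : ∃ t : Fin d → ℝ, ∀ k, t k = lam (σ k) / lam i₀ := ⟨_, fun _ => rfl⟩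
  obtain ⟨MA, hMA⟩ : ∃ M : Matrix (Fin d) (Fin d) ℝ,
      M = Matrix.of fun k l => ⟪b (σ k), Aop (b (σ l))⟫_ℝ / lam i₀ ^ (r + 1) := ⟨_, rfl⟩
  obtain ⟨MB, hMB⟩ : ∃ M : Matrix (Fin d) (Fin d) ℝ,
      M = Matrix.of fun k l => ⟪b (σ k), Bop (b (σ l))⟫_ℝ / lam i₀ ^ (r + 1) := ⟨_, rfl⟩
  have ht01 : ∀ k, 0 ≤ t k ∧ t k ≤ 1 := fun k => by
    rw [ht]
    exact ⟨div_nonneg (hnn _) hL.le, div_le_one_of_le₀ (hle _) hL.le⟩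
  have ht₀ : t (e ⟨i₀, hi₀⟩) = 1 := by rw [ht, hσ₀, div_self hL0]
  have hpow : ∀ n : ℕ, Matrix.toEuclideanCLM (𝕜 := ℝ) (Matrix.diagonal t) ^ n =
      Matrix.toEuclideanCLM (𝕜 := ℝ) (Matrix.diagonal t ^ n) := fun n => (map_pow _ _ n).symm
  -- the trace identities: the powers of `λ_{i₀}` cancel
  have eZ : ∀ n : ℕ,
      LinearMap.trace ℝ _ (↑(Matrix.toEuclideanCLM (𝕜 := ℝ) (Matrix.diagonal t) ^ n) :
        EuclideanSpace ℝ (Fin d) →ₗ[ℝ] EuclideanSpace ℝ (Fin d)) =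
      (∑ i ∈ F, lam i ^ n) / lam i₀ ^ n := fun n => by
    rw [hpow, trace_toEuclideanCLM, trace_diagonal_pow, ← reidx (fun i => lam i ^ n),
      Finset.sum_div]
    exact Finset.sum_congr rfl fun k _ => by rw [ht, div_pow]
  have eD : ∀ (A : E →L[ℝ] E) (M : Matrix (Fin d) (Fin d) ℝ),
      M = Matrix.of (fun k l => ⟪b (σ k), A (b (σ l))⟫_ℝ / lam i₀ ^ (r + 1)) →
      LinearMap.trace ℝ _
          (↑(Matrix.toEuclideanCLM (𝕜 := ℝ) (Matrix.diagonal t) ^ (r + a + b' + 5) *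
              Matrix.toEuclideanCLM (𝕜 := ℝ) M) :
            EuclideanSpace ℝ (Fin d) →ₗ[ℝ] EuclideanSpace ℝ (Fin d)) =
        (∑ i ∈ F, lam i ^ (r + a + b' + 5) * ⟪b i, A (b i)⟫_ℝ) /
          lam i₀ ^ (2 * r + a + b' + 4 + 2) := by
    intro A M hM
    rw [hpow, ← map_mul, trace_toEuclideanCLM, trace_diagonal_pow_mul,
      ← reidx (fun i => lam i ^ (r + a + b' + 5) * ⟪b i, A (b i)⟫_ℝ), Finset.sum_div]
    refine Finset.sum_congr rfl fun k _ => ?_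
    rw [hM, Matrix.of_apply, ht, div_pow, div_mul_div_comm]
    congr 1
    ring
  have eP : LinearMap.trace ℝ _
      (↑(Matrix.toEuclideanCLM (𝕜 := ℝ) (Matrix.diagonal t) ^ (b' + 2) *
          Matrix.toEuclideanCLM (𝕜 := ℝ) MA *
          Matrix.toEuclideanCLM (𝕜 := ℝ) (Matrix.diagonal t) ^ (a + 2) *
          Matrix.toEuclideanCLM (𝕜 := ℝ) MB) :
        EuclideanSpace ℝ (Fin d) →ₗ[ℝ] EuclideanSpace ℝ (Fin d)) =
      (∑ pr ∈ F ×ˢ F, lam pr.2 ^ (a + 2) * lam pr.1 ^ (b' + 2) * ⟪b pr.1, Aop (b pr.2)⟫_ℝ *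
        ⟪b pr.2, Bop (b pr.1)⟫_ℝ) / lam i₀ ^ (2 * r + a + b' + 4 + 2) := by
    rw [hpow, hpow, ← map_mul, ← map_mul, ← map_mul, trace_toEuclideanCLM,
      trace_diagonal_pow_mul_mul, ← reidx₂ (fun i j => lam j ^ (a + 2) * lam i ^ (b' + 2) *
        ⟪b i, Aop (b j)⟫_ℝ * ⟪b j, Bop (b i)⟫_ℝ), Finset.sum_div]
    refine Finset.sum_congr rfl fun k _ => ?_
    rw [Finset.sum_div]
    refine Finset.sum_congr rfl fun l _ => ?_
    rw [hMA, hMB, Matrix.of_apply, Matrix.of_apply, ht, ht, div_pow, div_pow, div_mul_div_comm,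
      div_mul_div_comm, div_mul_div_comm]
    congr 1 <;> ring
  -- the model
  refine ⟨d, Matrix.toEuclideanCLM (𝕜 := ℝ) (Matrix.diagonal t), Matrix.toEuclideanCLM (𝕜 := ℝ) MA,
    Matrix.toEuclideanCLM (𝕜 := ℝ) MB, EuclideanSpace.single (e ⟨i₀, hi₀⟩) 1,
    isPositive_toEuclideanCLM_diagonal fun k => (ht01 k).1, by simp,
    toEuclideanCLM_diagonal_single ht₀, fun v _ => norm_toEuclideanCLM_diagonal_apply_le ht01 v,
    ContinuousLinearMap.opNorm_le_bound _ zero_le_one fun v => by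
      rw [one_mul]; exact norm_toEuclideanCLM_diagonal_apply_le ht01 v,
    by rw [hMA]; exact norm_toEuclideanCLM_compression_div_le hu Aop (pow_pos hL _) hA,
    by rw [hMB]; exact norm_toEuclideanCLM_compression_div_le hu Bop (pow_pos hL _) hB,
    fun m => ?_, ?_⟩
  · -- trace excesses
    refine sub_le_sub_right ?_ 1
    rw [eZ]
    exact div_le_div_of_nonneg_right
      ((hsumPow (m + 2) (by omega)).sum_le_tsum F fun j _ => pow_nonneg (hnn j) _)
      (pow_nonneg hL.le _)
  · -- the correlation: model quantity = partial-sum quantity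
    rw [eP, eD Aop MA hMA, eD Bop MB hMB, eZ, div_div_div_cancel_right₀ (pow_ne_zero _ hL0),
      div_div_div_cancel_right₀ (pow_ne_zero _ hL0), div_div_div_cancel_right₀ (pow_ne_zero _ hL0)]
    exact hF

end Main

end Summit.QuantumFields.YangMills.Theorems.WeakCouplingHypercubicLimit.TraceNormColdPressure

end
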